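import Summits.FinalStateConjecture.FinalStateConjecture.Theorems.UniformPhotonSphereChannels.Negative.CommutedField
import Summits.FinalStateConjecture.FinalStateConjecture.Theorems.PhotonSphereChannelsEnergyConservation

/-!
# Crux `UniformPhotonSphereChannels` (K1), negative side — approximate conservation of the energy
# and of the commuted energy for a slowly varying potential

Support file of the standing disprover of item stmt-FinalStateConjecture-10045 (rest-packet pinning,
step 1).  Setting ("pinning set-up", repeated as hypotheses): `u ∈ C³(ℝ²)` solves
`u_tt − u_xx + W u = 0` with `W ∈ C¹`, `W ≥ 0`; `u` vanishes on `{x + |t| < Xl}` and on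
`{Xr < x − |t|}` (finite speed of propagation for data supported in `[Xl, Xr]`); on the solid
region `K = {0 ≤ t ≤ T₁, Xl − t ≤ x ≤ Xr + t}` the potential is bounded below by `W_min > 0` and
its partials by `D`.  With `E(t) = ∫_A^B e`, `A = Xl − T₁ − 1`, `B = Xr + T₁ + 1`:

* `energy_le_two_mul`: `E(t) ≤ 2 E(0)` on `[0, T₁]` if `T₁ D ≤ W_min/2`;
* `commutedEnergy_le`: for `v = ∂ₓu`, `E[v](t) ≤ 2 E[v](0) + 16 T₁² D² E(0)/W_min` on `[0, T₁]`
  if `T₁ D ≤ W_min/4` (AM–GM with weight `1/4T₁`, no square roots).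

Both are the `WaveDefect` identity on the fixed interval `[A, B]` plus a Grönwall-free bootstrap
(`bootstrap_le_two_mul`). [folklore]
-/

namespace Summit.FinalStateConjecture.FinalStateConjecture.Theorems

open MeasureTheory Set Filter Topology intervalIntegral

noncomputable section

namespace WaveDefect

open WaveEnergy

/-- Grönwall-free bootstrap: a continuous non-negative `E` on `[0, T₁]` with
`E(T) ≤ a + k ∫₀ᵀ E`, `k ≥ 0`, `k T₁ ≤ 1/2`, satisfies `E ≤ 2a`. -/
theorem bootstrap_le_two_mul {E : ℝ → ℝ} {T₁ a k : ℝ} (hT₁ : 0 ≤ T₁)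
    (hEc : ContinuousOn E (Icc 0 T₁)) (hE0 : ∀ T ∈ Icc 0 T₁, 0 ≤ E T) (hk : 0 ≤ k)
    (hkT : k * T₁ ≤ 1 / 2)
    (hineq : ∀ T ∈ Icc 0 T₁, E T ≤ a + k * ∫ t in (0 : ℝ)..T, E t) :
    ∀ T ∈ Icc 0 T₁, E T ≤ 2 * a := by
  obtain ⟨Ts, hTs, hmax⟩ := (isCompact_Icc (a := (0 : ℝ)) (b := T₁)).exists_isMaxOn
    (nonempty_Icc.mpr hT₁) hEc
  have hbar : ∀ T ∈ Icc 0 T₁, E T ≤ E Ts := fun T hT => hmax hT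
  have hint : ∀ T ∈ Icc 0 T₁, ∫ t in (0 : ℝ)..T, E t ≤ T * E Ts := by
    intro T hT
    have hsub : Icc 0 T ⊆ Icc 0 T₁ := Icc_subset_Icc le_rfl hT.2
    have h1 : ∫ t in (0 : ℝ)..T, E t ≤ ∫ t in (0 : ℝ)..T, E Ts := by
      refine intervalIntegral.integral_mono_on hT.1
        ((hEc.mono hsub).intervalIntegrable_of_Icc hT.1) ?_ fun t ht => hbar t (hsub ht)
      exact _root_.intervalIntegrable_const
    rw [intervalIntegral.integral_const, smul_eq_mul, sub_zero] at h1
    linarith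
  have hTs' := hineq Ts hTs
  have h2 : k * ∫ t in (0 : ℝ)..Ts, E t ≤ k * (Ts * E Ts) := mul_le_mul_of_nonneg_left (hint Ts hTs) hk
  have h3 : k * (Ts * E Ts) ≤ (1 / 2) * E Ts := by
    have : k * Ts ≤ 1 / 2 := (mul_le_mul_of_nonneg_left hTs.2 hk).trans hkT
    calc k * (Ts * E Ts) = (k * Ts) * E Ts := by ring
      _ ≤ (1 / 2) * E Ts := mul_le_mul_of_nonneg_right this (hE0 Ts hTs)
  intro T hT
  have := hbar T hT
  linarith

variable {u W : ℝ × ℝ → ℝ} {Xl Xr : ℝ}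

/-- Vanishing of `u` and its first two derivatives on the open set `{x + |t| < Xl}`. -/
theorem vanish_left (hzeroL : ∀ z : ℝ × ℝ, z.2 + |z.1| < Xl → u z = 0)
    {z : ℝ × ℝ} (hz : z.2 + |z.1| < Xl) :
    u z = 0 ∧ fderiv ℝ u z = 0 ∧ ∀ e : ℝ × ℝ, fderiv ℝ (fun w => fderiv ℝ u w e) z = 0 := by
  have hO : IsOpen {w : ℝ × ℝ | w.2 + |w.1| < Xl} := isOpen_lt (by fun_prop) continuous_const
  have hev : ∀ w ∈ {w : ℝ × ℝ | w.2 + |w.1| < Xl}, u =ᶠ[𝓝 w] fun _ => 0 := fun w hw => by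
    filter_upwards [hO.mem_nhds hw] with w' hw'
    exact hzeroL w' hw'
  refine ⟨hzeroL z hz, fderiv_eq_zero_of_eventuallyEq_zero (hev z hz), fun e => ?_⟩
  have hev' : (fun w => fderiv ℝ u w e) =ᶠ[𝓝 z] fun _ => 0 := by
    filter_upwards [hO.mem_nhds hz] with w hw
    rw [fderiv_eq_zero_of_eventuallyEq_zero (hev w hw)]
    rfl
  rw [hev'.fderiv_eq]
  simp

/-- Vanishing of `u` and its first two derivatives on the open set `{Xr < x − |t|}`. -/
theorem vanish_right (hzeroR : ∀ z : ℝ × ℝ, Xr < z.2 - |z.1| → u z = 0)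
    {z : ℝ × ℝ} (hz : Xr < z.2 - |z.1|) :
    u z = 0 ∧ fderiv ℝ u z = 0 ∧ ∀ e : ℝ × ℝ, fderiv ℝ (fun w => fderiv ℝ u w e) z = 0 := by
  have hO : IsOpen {w : ℝ × ℝ | Xr < w.2 - |w.1|} := isOpen_lt continuous_const (by fun_prop)
  have hev : ∀ w ∈ {w : ℝ × ℝ | Xr < w.2 - |w.1|}, u =ᶠ[𝓝 w] fun _ => 0 := fun w hw => by
    filter_upwards [hO.mem_nhds hw] with w' hw'
    exact hzeroR w' hw'
  refine ⟨hzeroR z hz, fderiv_eq_zero_of_eventuallyEq_zero (hev z hz), fun e => ?_⟩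
  have hev' : (fun w => fderiv ℝ u w e) =ᶠ[𝓝 z] fun _ => 0 := by
    filter_upwards [hO.mem_nhds hz] with w hw
    rw [fderiv_eq_zero_of_eventuallyEq_zero (hev w hw)]
    rfl
  rw [hev'.fderiv_eq]
  simp

/-- **Approximate energy conservation.**  In the pinning set-up (module docstring), if
`T₁ D ≤ W_min / 2` then `∫_A^B e(T,·) ≤ 2 ∫_A^B e(0,·)` for `T ∈ [0, T₁]`,
`e = u_t² + u_x² + W u²`, `A = Xl − T₁ − 1`, `B = Xr + T₁ + 1`. [folklore] -/
theorem energy_le_two_mul (hu : ContDiff ℝ 3 u) (hW : ContDiff ℝ 1 W) (hW0 : ∀ z, 0 ≤ W z)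
    (hsol : ∀ z : ℝ × ℝ, fderiv ℝ (fderiv ℝ u) z (1, 0) (1, 0)
      - fderiv ℝ (fderiv ℝ u) z (0, 1) (0, 1) + W z * u z = 0)
    (hzeroL : ∀ z : ℝ × ℝ, z.2 + |z.1| < Xl → u z = 0)
    (hzeroR : ∀ z : ℝ × ℝ, Xr < z.2 - |z.1| → u z = 0)
    (hX : Xl ≤ Xr) {T₁ Wmin D : ℝ} (hT₁ : 0 < T₁) (hWmin : 0 < Wmin) (hD : 0 ≤ D)
    (hWK : ∀ z : ℝ × ℝ, z.1 ∈ Icc 0 T₁ → Xl - z.1 ≤ z.2 → z.2 ≤ Xr + z.1 → Wmin ≤ W z)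
    (hDK : ∀ z : ℝ × ℝ, z.1 ∈ Icc 0 T₁ → Xl - z.1 ≤ z.2 → z.2 ≤ Xr + z.1 → |fderiv ℝ W z (1, 0)| ≤ D)
    (hsmall : T₁ * D ≤ Wmin / 2)
    {e : ℝ × ℝ → ℝ}
    (he : ∀ z, e z = (fderiv ℝ u z (1, 0)) ^ 2 + (fderiv ℝ u z (0, 1)) ^ 2 + W z * u z ^ 2) :
    ∀ T ∈ Icc 0 T₁, (∫ X in (Xl - T₁ - 1)..(Xr + T₁ + 1), e (T, X))
      ≤ 2 * ∫ X in (Xl - T₁ - 1)..(Xr + T₁ + 1), e (0, X) := by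
  have hu2 : ContDiff ℝ 2 u := hu.of_le (by norm_num)
  set A : ℝ := Xl - T₁ - 1 with hA
  set B : ℝ := Xr + T₁ + 1 with hB
  set m : ℝ × ℝ → ℝ := fun z => 2 * fderiv ℝ u z (1, 0) * fderiv ℝ u z (0, 1) with hmdef
  have hm : ∀ z, m z = 2 * fderiv ℝ u z (1, 0) * fderiv ℝ u z (0, 1) := fun z => rfl
  set F : ℝ × ℝ → ℝ := fun z => fderiv ℝ (fderiv ℝ u) z (1, 0) (1, 0)
      - fderiv ℝ (fderiv ℝ u) z (0, 1) (0, 1) + W z * u z with hFdef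
  have hF : ∀ z, F z = fderiv ℝ (fderiv ℝ u) z (1, 0) (1, 0)
      - fderiv ℝ (fderiv ℝ u) z (0, 1) (0, 1) + W z * u z := fun z => rfl
  have hec : Continuous e := (differentiable_energyDensity hu2 (hW.differentiable (by norm_num)) he).continuous
  have he0 : ∀ z, 0 ≤ e z := energyDensity_nonneg hW0 he
  set E : ℝ → ℝ := fun T => ∫ X in A..B, e (T, X) with hE
  -- continuity of `E`
  have hEc : Continuous E :=
    intervalIntegral.continuous_parametric_intervalIntegral_of_continuous' (f := fun T X => e (T, X))
      (show Continuous fun p : ℝ × ℝ => e (p.1, p.2) from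
        hec.comp (continuous_fst.prodMk continuous_snd)) A B
  -- boundary terms vanish
  have hbdA : ∀ t ∈ Icc 0 T₁, m (t, A) = 0 := by
    intro t ht
    have hz : (t, A).2 + |(t, A).1| < Xl := by
      simp only; rw [abs_of_nonneg ht.1, hA]; linarith [ht.2]
    obtain ⟨-, h1, -⟩ := vanish_left hzeroL hz
    simp [hm, h1]
  have hbdB : ∀ t ∈ Icc 0 T₁, m (t, B) = 0 := by
    intro t ht
    have hz : Xr < (t, B).2 - |(t, B).1| := by
      simp only; rw [abs_of_nonneg ht.1, hB]; linarith [ht.2]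
    obtain ⟨-, h1, -⟩ := vanish_right hzeroR hz
    simp [hm, h1]
  -- pointwise source bound on the slab
  have hsrc : ∀ t ∈ Icc 0 T₁, ∀ X, 2 * fderiv ℝ u (t, X) (1, 0) * F (t, X)
      + fderiv ℝ W (t, X) (1, 0) * u (t, X) ^ 2 ≤ D / Wmin * e (t, X) := by
    intro t ht X
    rw [hF, hsol (t, X), mul_zero, zero_add]
    by_cases hK : Xl - t ≤ X ∧ X ≤ Xr + t
    · have hW1 := hWK (t, X) ht hK.1 hK.2
      have hD1 := hDK (t, X) ht hK.1 hK.2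
      have hu2' : Wmin * u (t, X) ^ 2 ≤ e (t, X) := by
        rw [he]
        nlinarith [sq_nonneg (fderiv ℝ u (t, X) (1, 0)), sq_nonneg (fderiv ℝ u (t, X) (0, 1)),
          mul_le_mul_of_nonneg_right hW1 (sq_nonneg (u (t, X)))]
      have h3 : fderiv ℝ W (t, X) (1, 0) * u (t, X) ^ 2 ≤ D * u (t, X) ^ 2 :=
        mul_le_mul_of_nonneg_right (le_of_abs_le hD1) (sq_nonneg _)
      have h4 : D * u (t, X) ^ 2 ≤ D / Wmin * e (t, X) := by
        rw [div_mul_eq_mul_div, le_div_iff₀ hWmin]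
        nlinarith [mul_le_mul_of_nonneg_left hu2' hD]
      linarith
    · have hz : u (t, X) = 0 := by
        rcases not_and_or.mp hK with h | h
        · push Not at h
          exact hzeroL (t, X) (by simp only; rw [abs_of_nonneg ht.1]; linarith)
        · push Not at h
          exact hzeroR (t, X) (by simp only; rw [abs_of_nonneg ht.1]; linarith)
      rw [hz]
      have := he0 (t, X)
      have : 0 ≤ D / Wmin * e (t, X) := by positivity
      simpa using this
  -- the integral inequality
  have hineq : ∀ T ∈ Icc 0 T₁, E T ≤ E 0 + D / Wmin * ∫ t in (0 : ℝ)..T, E t := by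
    intro T hT
    have key := energy_identity_affine_source hu2 hW he hm hF A 0 B 0 0 T
    simp only [zero_mul, add_zero] at key
    have hbd : (∫ t in (0 : ℝ)..T, (m (t, B) - m (t, A))) = 0 := by
      refine (intervalIntegral.integral_congr (g := fun _ => (0 : ℝ)) fun t ht => ?_).trans (by simp)
      rw [uIcc_of_le hT.1] at ht
      have ht' : t ∈ Icc 0 T₁ := ⟨ht.1, ht.2.trans hT.2⟩
      simp [hbdA t ht', hbdB t ht']
    rw [hbd, zero_add] at key
    have hsrc_int : (∫ t in (0 : ℝ)..T, ∫ X in A..B,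
        (2 * fderiv ℝ u (t, X) (1, 0) * F (t, X) + fderiv ℝ W (t, X) (1, 0) * u (t, X) ^ 2))
        ≤ ∫ t in (0 : ℝ)..T, D / Wmin * E t := by
      have hAB : A ≤ B := by rw [hA, hB]; linarith
      refine intervalIntegral.integral_mono_on hT.1 ?_ ?_ fun t ht => ?_
      · -- integrability of the iterated source integral (continuous integrand)
        have hc : Continuous fun p : ℝ × ℝ => 2 * fderiv ℝ u p (1, 0) * F p + fderiv ℝ W p (1, 0) * u p ^ 2 := by
          have h1 := continuous_fderiv_apply hu2 (1, 0)
          have h2 := continuous_defect hu2 hW.continuous hF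
          have h3 : Continuous fun p : ℝ × ℝ => fderiv ℝ W p (1, 0) :=
            (hW.continuous_fderiv (by norm_num)).clm_apply continuous_const
          exact ((continuous_const.mul h1).mul h2).add (h3.mul (hu2.continuous.pow 2))
        exact (intervalIntegral.continuous_parametric_intervalIntegral_of_continuous'
          (f := fun t X => 2 * fderiv ℝ u (t, X) (1, 0) * F (t, X) + fderiv ℝ W (t, X) (1, 0) * u (t, X) ^ 2)
          (show Continuous fun p : ℝ × ℝ => 2 * fderiv ℝ u (p.1, p.2) (1, 0) * F (p.1, p.2)
              + fderiv ℝ W (p.1, p.2) (1, 0) * u (p.1, p.2) ^ 2 from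
            hc.comp (continuous_fst.prodMk continuous_snd)) A B).intervalIntegrable _ _
      · exact (continuous_const.mul hEc).intervalIntegrable _ _
      · have ht' : t ∈ Icc 0 T₁ := ⟨ht.1, ht.2.trans hT.2⟩
        rw [hE]
        simp only
        rw [← intervalIntegral.integral_const_mul]
        refine intervalIntegral.integral_mono_on hAB ?_ ?_ fun X _ => hsrc t ht' X
        · have hc : Continuous fun X => 2 * fderiv ℝ u (t, X) (1, 0) * F (t, X)
              + fderiv ℝ W (t, X) (1, 0) * u (t, X) ^ 2 := by
            have h1 := (continuous_fderiv_apply hu2 (1, 0)).comp (Continuous.prodMk_right t)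
            have h2 := (continuous_defect hu2 hW.continuous hF).comp (Continuous.prodMk_right t)
            have h3 : Continuous fun X => fderiv ℝ W (t, X) (1, 0) :=
              ((hW.continuous_fderiv (by norm_num)).clm_apply continuous_const).comp (Continuous.prodMk_right t)
            exact ((continuous_const.mul h1).mul h2).add (h3.mul ((hu2.continuous.comp (Continuous.prodMk_right t)).pow 2))
          exact hc.intervalIntegrable _ _
        · exact (continuous_const.mul (hec.comp (Continuous.prodMk_right t))).intervalIntegrable _ _
    rw [intervalIntegral.integral_const_mul] at hsrc_int
    have : E T - E 0 = ∫ t in (0 : ℝ)..T, ∫ X in A..B,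
        (2 * fderiv ℝ u (t, X) (1, 0) * F (t, X) + fderiv ℝ W (t, X) (1, 0) * u (t, X) ^ 2) := key
    linarith
  have hE0' : ∀ T ∈ Icc 0 T₁, 0 ≤ E T := fun T _ =>
    intervalIntegral.integral_nonneg (by rw [hA, hB]; linarith) fun X _ => he0 _
  have hk : 0 ≤ D / Wmin := by positivity
  have hkT : D / Wmin * T₁ ≤ 1 / 2 := by
    rw [div_mul_eq_mul_div, div_le_iff₀ hWmin]; linarith
  exact bootstrap_le_two_mul hT₁.le hEc.continuousOn hE0' hk hkT hineq

end WaveDefect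

end

end Summit.FinalStateConjecture.FinalStateConjecture.Theorems
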